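import Mathlib
import Summits.ValiantsHypothesis.ValiantsHypothesis.Theses.CirculantFourier

/-!
# Support law (zero-transmission law) for the circulant permanent in Fourier coordinates

Route `CirculantFourier`, item `SupportLaw` (stmt-ValiantsHypothesis-6307): every monomial `μ^α`
of `QF_n(μ) := per(circulant x)` after the Fourier substitution `x_d = Σ_m ω^{dm} μ_m`
(`ω = e^{2πi/n}`) has charge `Σ_m m·α_m ≡ 0 (mod n)`.

Proof (symmetry / zero-transmission law, Tichy et al. 2010): the torus scaling
`μ_m ↦ ω^m μ_m` composed with the Fourier substitution equals the Fourier substitution composed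
with the cyclic shift `x_d ↦ x_{d+1}`; the circulant permanent is invariant under that shift
(it permutes the rows of the circulant matrix); hence `coeff_α QF_n = ω^{charge α} · coeff_α QF_n`,
and a nonzero coefficient forces `ω^{charge α} = 1`, i.e. `n ∣ charge α`.
-/

namespace Summit.ValiantsHypothesis.ValiantsHypothesis.Theorems

-- `Summit.<Summit>.<Problem>` with Problem = Summit is the mandated single-conjunct layout (D-0017).
set_option linter.dupNamespace false

open MvPolynomial

/-- Coefficients of a polynomial after the torus scaling `μ_m ↦ ω^m μ_m`: the coefficient of
`μ^α` is multiplied by `ω^{charge α}`, `charge α = Σ_j j·α_j`. -/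
theorem circFourier_coeff_aeval_scale {N : ℕ} (ω : ℂ) (p : MvPolynomial (Fin N) ℂ)
    (α : Fin N →₀ ℕ) :
    coeff α (aeval (fun m : Fin N => C (ω ^ (m : ℕ)) * X m) p) =
      ω ^ (∑ j : Fin N, (j : ℕ) * α j) * coeff α p := by
  induction p using MvPolynomial.induction_on' with
  | monomial β c =>
    have hprod : (∏ i : Fin N, ((C (ω ^ (i : ℕ)) * X i : MvPolynomial (Fin N) ℂ)) ^ β i)
        = C (ω ^ (∑ j : Fin N, (j : ℕ) * β j)) * monomial β 1 := by
      simp_rw [mul_pow, Finset.prod_mul_distrib, ← map_pow, ← map_prod, ← pow_mul,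
        Finset.prod_pow_eq_pow_sum]
      rw [monomial_eq, C_1, one_mul, Finsupp.prod_pow]
    rw [aeval_monomial, Finsupp.prod_pow, hprod, algebraMap_eq, C_mul_monomial, C_mul_monomial,
      coeff_monomial, coeff_monomial]
    split_ifs with h
    · subst h; ring
    · simp
  | add p q hp hq => simp only [map_add, coeff_add, hp, hq, mul_add]

/-- The Fourier coefficient `e^{2πi·d·m/N}` is the `(d·m)`-th power of `ω = e^{2πi/N}`. -/
theorem circFourier_exp_eq_pow (N d m : ℕ) :
    Complex.exp (2 * Real.pi * Complex.I * (d : ℂ) * (m : ℂ) / (N : ℂ)) =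
      Complex.exp (2 * Real.pi * Complex.I / (N : ℂ)) ^ (d * m) := by
  rw [← Complex.exp_nat_mul]; congr 1; push_cast; ring

/-- Powers of a root of unity only depend on the exponent modulo the order. -/
theorem circFourier_pow_congr_mod {ω : ℂ} {N a b : ℕ} (h : ω ^ N = 1) (hab : a % N = b % N) :
    ω ^ a = ω ^ b := by
  rw [pow_eq_pow_mod a h, pow_eq_pow_mod b h, hab]

/-- Key symmetry: the torus scaling `μ_m ↦ ω^m μ_m` after the Fourier substitution is the Fourier
substitution after the cyclic shift of variables `x_d ↦ x_{d+1}`. -/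
theorem circFourier_scale_comp_subst (k : ℕ) :
    (aeval (fun m : Fin (k + 1) =>
        C (Complex.exp (2 * Real.pi * Complex.I / ((k + 1 : ℕ) : ℂ)) ^ (m : ℕ)) * X m)).comp
      (aeval (fun d : Fin (k + 1) => ∑ m : Fin (k + 1),
        MvPolynomial.C (Complex.exp (2 * Real.pi * Complex.I * ((d : ℕ) : ℂ) * ((m : ℕ) : ℂ) /
          ((k + 1 : ℕ) : ℂ))) * MvPolynomial.X m))
    = (aeval (fun d : Fin (k + 1) => ∑ m : Fin (k + 1),
        MvPolynomial.C (Complex.exp (2 * Real.pi * Complex.I * ((d : ℕ) : ℂ) * ((m : ℕ) : ℂ) /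
          ((k + 1 : ℕ) : ℂ))) * MvPolynomial.X m)).comp
      (rename (fun d : Fin (k + 1) => d + 1)) := by
  apply MvPolynomial.algHom_ext
  intro d
  simp only [AlgHom.comp_apply, aeval_X, rename_X, map_sum, map_mul, algHom_C, algebraMap_eq]
  refine Finset.sum_congr rfl fun m _ => ?_
  rw [← mul_assoc, ← map_mul]
  congr 2
  rw [circFourier_exp_eq_pow, circFourier_exp_eq_pow, ← pow_add]
  have hω := Complex.isPrimitiveRoot_exp (k + 1) (Nat.succ_ne_zero k)
  apply circFourier_pow_congr_mod hω.pow_eq_one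
  rw [Fin.val_add, Fin.val_one', Nat.add_mod_mod, Nat.mul_mod, Nat.mod_mod, ← Nat.mul_mod]
  congr 1; ring

/-- The circulant permanent is invariant under the cyclic shift of variables `x_d ↦ x_{d+1}`
(the shift permutes the rows of the circulant matrix). -/
theorem circFourier_rename_addOne_permanent (k : ℕ) :
    rename (fun d : Fin (k + 1) => d + 1)
      (Matrix.circulant fun i : Fin (k + 1) => (X i : MvPolynomial (Fin (k + 1)) ℂ)).permanent
    = (Matrix.circulant fun i : Fin (k + 1) => (X i : MvPolynomial (Fin (k + 1)) ℂ)).permanent := by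
  have h1 : ((Matrix.circulant fun i : Fin (k + 1) => (X i : MvPolynomial (Fin (k + 1)) ℂ)).map
      (rename (fun d : Fin (k + 1) => d + 1))).permanent = rename (fun d : Fin (k + 1) => d + 1)
      (Matrix.circulant fun i : Fin (k + 1) => (X i : MvPolynomial (Fin (k + 1)) ℂ)).permanent := by
    simp [Matrix.permanent, map_sum, map_prod]
  rw [← h1, Matrix.map_circulant]
  simp_rw [rename_X]
  have h2 : (Matrix.circulant fun i : Fin (k + 1) => (X (i + 1) : MvPolynomial (Fin (k + 1)) ℂ))
      = (Matrix.circulant fun i : Fin (k + 1) => (X i : MvPolynomial (Fin (k + 1)) ℂ)).submatrix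
          (Equiv.addRight (1 : Fin (k + 1))) id := by
    ext i j
    simp only [Matrix.circulant_apply, Matrix.submatrix_apply, Equiv.coe_addRight, id]
    rw [sub_add_eq_add_sub]
  rw [h2, Matrix.permanent_permute_cols]

/-- The support law on `Fin (k+1)`: a nonzero coefficient of `μ^α` in the Fourier form forces
`(k+1) ∣ Σ_j j·α_j`. -/
theorem circFourier_supportLaw_succ (k : ℕ) (α : Fin (k + 1) →₀ ℕ)
    (hα : coeff α (aeval (fun d : Fin (k + 1) => ∑ m : Fin (k + 1),
        MvPolynomial.C (Complex.exp (2 * Real.pi * Complex.I * ((d : ℕ) : ℂ) * ((m : ℕ) : ℂ) /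
          ((k + 1 : ℕ) : ℂ))) * MvPolynomial.X m)
      (Matrix.circulant fun i : Fin (k + 1) => (X i : MvPolynomial (Fin (k + 1)) ℂ)).permanent) ≠ 0) :
    (∑ j : Fin (k + 1), (j : ℕ) * α j) % (k + 1) = 0 := by
  set ω : ℂ := Complex.exp (2 * Real.pi * Complex.I / ((k + 1 : ℕ) : ℂ))
  have hω : IsPrimitiveRoot ω (k + 1) := Complex.isPrimitiveRoot_exp (k + 1) (Nat.succ_ne_zero k)
  set φ : MvPolynomial (Fin (k + 1)) ℂ →ₐ[ℂ] MvPolynomial (Fin (k + 1)) ℂ :=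
    aeval (fun d : Fin (k + 1) => ∑ m : Fin (k + 1),
        MvPolynomial.C (Complex.exp (2 * Real.pi * Complex.I * ((d : ℕ) : ℂ) * ((m : ℕ) : ℂ) /
          ((k + 1 : ℕ) : ℂ))) * MvPolynomial.X m)
  set q := (Matrix.circulant fun i : Fin (k + 1) => (X i : MvPolynomial (Fin (k + 1)) ℂ)).permanent
  have hfix : aeval (fun m : Fin (k + 1) => C (ω ^ (m : ℕ)) * X m) (φ q) = φ q := by
    have h := congrArg (fun F => F q) (circFourier_scale_comp_subst k)
    simp only [AlgHom.comp_apply] at h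
    rw [circFourier_rename_addOne_permanent] at h
    exact h
  have hcoeff := circFourier_coeff_aeval_scale ω (φ q) α
  rw [hfix] at hcoeff
  have hpow : ω ^ (∑ j : Fin (k + 1), (j : ℕ) * α j) = 1 := by
    have h0 : (ω ^ (∑ j : Fin (k + 1), (j : ℕ) * α j) - 1) * coeff α (φ q) = 0 := by
      rw [sub_mul, one_mul, ← hcoeff, sub_self]
    rcases mul_eq_zero.mp h0 with h | h
    · exact sub_eq_zero.mp h
    · exact absurd h hα
  exact Nat.mod_eq_zero_of_dvd ((hω.pow_eq_one_iff_dvd _).mp hpow)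

/-- **Support law** (zero-transmission law) for route `CirculantFourier`: every monomial `μ^α`
with nonzero coefficient in the Fourier form `QF_n` of the circulant permanent has charge
`Σ_j j·α_j ≡ 0 (mod n)`. Closes item stmt-ValiantsHypothesis-6307. -/
theorem supportLaw_proof :
    Summit.ValiantsHypothesis.ValiantsHypothesis.Theses.CirculantFourier.SupportLaw := by
  unfold Summit.ValiantsHypothesis.ValiantsHypothesis.Theses.CirculantFourier.SupportLaw
  intro n hn α hα
  obtain ⟨k, rfl⟩ : ∃ k, n = k + 1 := ⟨n - 1, by omega⟩
  exact circFourier_supportLaw_succ k α hα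

end Summit.ValiantsHypothesis.ValiantsHypothesis.Theorems
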